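import Summits.AtomisticToContinuum.FouriersLaw.Theorems.HiddenChargeMazurStaticKuboStubLasotaYorkeAux1
import Literature.MathematicalPhysics.KineticTheory.LangevinChainTheorem51
import Mathlib.Analysis.Convex.Integral
import Mathlib.Analysis.Convex.SpecificFunctions.Basic
import Mathlib.MeasureTheory.Integral.MeanInequalities

/-!
# `HiddenChargeMazur.StaticKubo`, line `birth`, stub `stub_lasotaYorke` — aux 2: moment bounds along the flow

Helper file (`--supports stmt-AtomisticToContinuum-13510`, crux decl `HiddenChargeMazur.StaticKubo`,
skeleton `Cruxes/StaticKubo/Lines/birth.lean` rev 4, stub S5 `stub_lasotaYorke` of the lead).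

For the pinned anharmonic chain at equal bath temperatures `T` (solution map `X_t^x(ω) = solMap t x (pairPath ω)`
driven by the Brownian pair), consequences of the fixed-time exponential moment bound (3.4) of the tree
(`pinnedChain_lintegral_exp_hamiltonian_solMap_le`):

* `lintegral_mul_le_sqrt_mul_sqrt`, `lintegral_ofReal_mul_le` — Cauchy–Schwarz for lower integrals, in the
  real-valued packaging used downstream;
* `integrable_comp_solMap_of_abs_le` — observables with `|φ| ≤ M e^{ϑH}`, `ϑ < 1/T`, are integrable along the flow;
* `lintegral_exp_mul_sqrt_hamiltonian_solMap_le` — **`E exp(c √H(X_t^x)) ≤ exp(A_c + B_c √H(x))`** for `t ≤ 1`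
  (`√h ≤ ηh + 1/(4η)` with `η ∼ 1/(1 + √H(x))`, then (3.4));
* `lintegral_exp_mul_flowRate_le` — **the exponential moment of the coupling rate**
  `Λ = ∫₀¹ C₀(1 + √H(X_s^x) + √H(X_s^y)) ds`: `E e^{pΛ} ≤ exp(pC₀ + A + B(√H(x) + √H(y)))`
  (Jensen in time, Tonelli, Cauchy–Schwarz between the two starts, and the previous bound).

References: Cuneo–Eckmann–Hairer–Rey-Bellet 2018, §3 eq. (3.4); folklore. Nothing here closes the item.
-/

noncomputable section

open MeasureTheory Filter Topology Set Metric
open scoped NNReal ENNReal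
open Literature.MathematicalPhysics.KineticTheory.HeatConduction Literature.MathematicalPhysics.KineticTheory
open Literature.Probability.Process OscillatorChain

namespace Summit.AtomisticToContinuum.FouriersLaw.Cruxes.StaticKubo.Birth.Stubs

variable {N : ℕ}

/-! ### Cauchy–Schwarz for lower integrals -/

section CauchySchwarz

variable {Ω : Type*} [MeasurableSpace Ω] (μ : Measure Ω)

/-- Cauchy–Schwarz for lower integrals: `∫⁻ f g ≤ (∫⁻ f²)^{1/2} (∫⁻ g²)^{1/2}`. [folklore] -/
theorem lintegral_mul_le_sqrt_mul_sqrt {f g : Ω → ℝ≥0∞} (hf : AEMeasurable f μ) (hg : AEMeasurable g μ) :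
    ∫⁻ a, f a * g a ∂μ ≤ (∫⁻ a, f a ^ (2 : ℝ) ∂μ) ^ (1 / 2 : ℝ) * (∫⁻ a, g a ^ (2 : ℝ) ∂μ) ^ (1 / 2 : ℝ) := by
  have hpq : Real.HolderConjugate 2 2 := Real.holderConjugate_iff.2 ⟨by norm_num, by norm_num⟩
  have h := ENNReal.lintegral_mul_le_Lp_mul_Lq μ hpq hf hg
  simpa only [Pi.mul_apply] using h

/-- **Cauchy–Schwarz, real packaging**: if `a, b ≥ 0` are measurable with `∫⁻ ofReal(a²) ≤ ofReal A` and
`∫⁻ ofReal(b²) ≤ ofReal B` (`A, B ≥ 0`), then `∫⁻ ofReal(a b) ≤ ofReal(√A √B)`. [folklore] -/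
theorem lintegral_ofReal_mul_le {a b : Ω → ℝ} (ha : Measurable a) (hb : Measurable b)
    (ha0 : ∀ ω, 0 ≤ a ω) (hb0 : ∀ ω, 0 ≤ b ω) {A B : ℝ} (hA : 0 ≤ A) (hB : 0 ≤ B)
    (hIa : ∫⁻ ω, ENNReal.ofReal (a ω ^ 2) ∂μ ≤ ENNReal.ofReal A)
    (hIb : ∫⁻ ω, ENNReal.ofReal (b ω ^ 2) ∂μ ≤ ENNReal.ofReal B) :
    ∫⁻ ω, ENNReal.ofReal (a ω * b ω) ∂μ ≤ ENNReal.ofReal (Real.sqrt A * Real.sqrt B) := by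
  have hfa : AEMeasurable (fun ω => ENNReal.ofReal (a ω)) μ := (ENNReal.measurable_ofReal.comp ha).aemeasurable
  have hfb : AEMeasurable (fun ω => ENNReal.ofReal (b ω)) μ := (ENNReal.measurable_ofReal.comp hb).aemeasurable
  have h := lintegral_mul_le_sqrt_mul_sqrt μ hfa hfb
  have hsq : ∀ (c : Ω → ℝ), (∀ ω, 0 ≤ c ω) → ∀ ω, ENNReal.ofReal (c ω) ^ (2 : ℝ) = ENNReal.ofReal (c ω ^ 2) :=
    fun c hc ω => by rw [ENNReal.ofReal_rpow_of_nonneg (hc ω) (by norm_num), Real.rpow_two]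
  simp_rw [hsq a ha0, hsq b hb0] at h
  calc ∫⁻ ω, ENNReal.ofReal (a ω * b ω) ∂μ = ∫⁻ ω, ENNReal.ofReal (a ω) * ENNReal.ofReal (b ω) ∂μ :=
        lintegral_congr fun ω => ENNReal.ofReal_mul (ha0 ω)
    _ ≤ (∫⁻ ω, ENNReal.ofReal (a ω ^ 2) ∂μ) ^ (1 / 2 : ℝ) * (∫⁻ ω, ENNReal.ofReal (b ω ^ 2) ∂μ) ^ (1 / 2 : ℝ) := h
    _ ≤ ENNReal.ofReal A ^ (1 / 2 : ℝ) * ENNReal.ofReal B ^ (1 / 2 : ℝ) := by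
        gcongr
    _ = ENNReal.ofReal (Real.sqrt A * Real.sqrt B) := by
        rw [ENNReal.ofReal_rpow_of_nonneg hA (by norm_num), ENNReal.ofReal_rpow_of_nonneg hB (by norm_num),
          ← ENNReal.ofReal_mul (Real.rpow_nonneg hA _), Real.sqrt_eq_rpow, Real.sqrt_eq_rpow]

/-- **Cauchy–Schwarz with an event**: under the hypotheses of `lintegral_ofReal_mul_le` with a fourth
moment bound `∫⁻ ofReal(a⁴) ≤ ofReal A₄` instead, for a measurable set `S`,
`∫⁻_S ofReal(a b) ≤ ofReal(A₄^{1/4} √B) · μ(S)^{1/4}`. [folklore] -/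
theorem lintegral_indicator_ofReal_mul_le {a b : Ω → ℝ} (ha : Measurable a) (hb : Measurable b)
    (ha0 : ∀ ω, 0 ≤ a ω) (hb0 : ∀ ω, 0 ≤ b ω) {A₄ B : ℝ} (hA : 0 ≤ A₄) (hB : 0 ≤ B)
    (hIa : ∫⁻ ω, ENNReal.ofReal (a ω ^ 4) ∂μ ≤ ENNReal.ofReal A₄)
    (hIb : ∫⁻ ω, ENNReal.ofReal (b ω ^ 2) ∂μ ≤ ENNReal.ofReal B) {S : Set Ω} (hS : MeasurableSet S) :
    ∫⁻ ω, S.indicator (fun ω => ENNReal.ofReal (a ω * b ω)) ω ∂μ ≤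
      ENNReal.ofReal (A₄ ^ (1 / 4 : ℝ) * Real.sqrt B) * μ S ^ (1 / 4 : ℝ) := by
  -- write the indicator as a product with `1_S` and apply Cauchy–Schwarz to `(a 1_S) · b`
  set i : Ω → ℝ≥0∞ := S.indicator 1 with hi
  have him : Measurable i := measurable_one.indicator hS
  have hi2 : ∀ ω, i ω ^ (2 : ℝ) = i ω := fun ω => by
    by_cases hω : ω ∈ S <;> simp [hi, hω]
  have hfa : Measurable fun ω => ENNReal.ofReal (a ω) := ENNReal.measurable_ofReal.comp ha
  have hfb : Measurable fun ω => ENNReal.ofReal (b ω) := ENNReal.measurable_ofReal.comp hb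
  have hsq : ∀ (c : Ω → ℝ), (∀ ω, 0 ≤ c ω) → ∀ (ω) (p : ℕ), ENNReal.ofReal (c ω) ^ (p : ℝ) = ENNReal.ofReal (c ω ^ p) :=
    fun c hc ω p => by rw [ENNReal.ofReal_rpow_of_nonneg (hc ω) (by positivity), Real.rpow_natCast]
  have hind : ∀ ω, S.indicator (fun ω => ENNReal.ofReal (a ω * b ω)) ω =
      (ENNReal.ofReal (a ω) * i ω) * ENNReal.ofReal (b ω) := fun ω => by
    by_cases hω : ω ∈ S
    · simp [hi, hω, ENNReal.ofReal_mul (ha0 ω)]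
    · simp [hi, hω]
  simp_rw [hind]
  have h1 := lintegral_mul_le_sqrt_mul_sqrt μ ((hfa.mul him).aemeasurable) hfb.aemeasurable
  -- the first factor: `∫⁻ (a 1_S)² = ∫⁻ a² 1_S ≤ (∫⁻ a⁴)^{1/2} μ(S)^{1/2}`
  have h2 : ∫⁻ ω, (ENNReal.ofReal (a ω) * i ω) ^ (2 : ℝ) ∂μ ≤
      (ENNReal.ofReal A₄) ^ (1 / 2 : ℝ) * μ S ^ (1 / 2 : ℝ) := by
    have h3 : ∀ ω, (ENNReal.ofReal (a ω) * i ω) ^ (2 : ℝ) = ENNReal.ofReal (a ω) ^ (2 : ℝ) * i ω := fun ω => by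
      rw [ENNReal.mul_rpow_of_nonneg _ _ (by norm_num), hi2]
    simp_rw [h3]
    have h4 := lintegral_mul_le_sqrt_mul_sqrt μ ((hfa.pow_const (2 : ℝ)).aemeasurable) him.aemeasurable
    refine h4.trans ?_
    have h5 : ∫⁻ ω, (ENNReal.ofReal (a ω) ^ (2 : ℝ)) ^ (2 : ℝ) ∂μ ≤ ENNReal.ofReal A₄ := by
      refine le_trans (le_of_eq (lintegral_congr fun ω => ?_)) hIa
      rw [← ENNReal.rpow_mul, show (2 : ℝ) * 2 = ((4 : ℕ) : ℝ) by norm_num, hsq a ha0]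
    have h6 : ∫⁻ ω, i ω ^ (2 : ℝ) ∂μ = μ S := by
      simp_rw [hi2]
      rw [hi, lintegral_indicator_one hS]
    rw [h6]
    gcongr
  have hIb' : ∫⁻ ω, ENNReal.ofReal (b ω) ^ (2 : ℝ) ∂μ ≤ ENNReal.ofReal B := by
    refine le_trans (le_of_eq (lintegral_congr fun ω => ?_)) hIb
    rw [show (2 : ℝ) = ((2 : ℕ) : ℝ) by norm_num, hsq b hb0]
  calc ∫⁻ ω, ENNReal.ofReal (a ω) * i ω * ENNReal.ofReal (b ω) ∂μ
      ≤ (∫⁻ ω, (ENNReal.ofReal (a ω) * i ω) ^ (2 : ℝ) ∂μ) ^ (1 / 2 : ℝ) *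
          (∫⁻ ω, ENNReal.ofReal (b ω) ^ (2 : ℝ) ∂μ) ^ (1 / 2 : ℝ) := h1
    _ ≤ ((ENNReal.ofReal A₄) ^ (1 / 2 : ℝ) * μ S ^ (1 / 2 : ℝ)) ^ (1 / 2 : ℝ) * (ENNReal.ofReal B) ^ (1 / 2 : ℝ) := by
        gcongr
    _ = ENNReal.ofReal (A₄ ^ (1 / 4 : ℝ) * Real.sqrt B) * μ S ^ (1 / 4 : ℝ) := by
        rw [ENNReal.mul_rpow_of_nonneg _ _ (by norm_num), ← ENNReal.rpow_mul, ← ENNReal.rpow_mul,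
          ENNReal.ofReal_rpow_of_nonneg hA (by norm_num), ENNReal.ofReal_rpow_of_nonneg hB (by norm_num),
          ENNReal.ofReal_mul (Real.rpow_nonneg hA _), Real.sqrt_eq_rpow]
        norm_num
        ring

end CauchySchwarz

/-! ### Moments along the flow of the pinned chain -/

section Flow

variable {ω₂ lam β γ : ℝ} (hω : 0 < ω₂) (hl : 0 ≤ lam) (hβ : 0 ≤ β) (hγ : 0 ≤ γ) (hN : 0 < N)
  {T : ℝ} (hT : 0 < T)
include hω hl hβ hγ hN hT

-- the flow is a limit of Picard iterations: never let the unifier unfold it (heartbeats)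
attribute [local irreducible] OscillatorChain.chainFlow

/-- **Observables of exponential class are integrable along the flow**: if `φ` is continuous with
`|φ| ≤ M e^{ϑH}`, `0 < ϑ < 1/T`, then `ω ↦ φ(X_t^x(ω))` is integrable under the Wiener pair (by (3.4)).
[cite: CuneoEckmannHairerReyBellet2018, §3 eq. (3.4)] -/
theorem integrable_comp_solMap_of_abs_le {φ : PhaseSpace N → ℝ} (hφ : Continuous φ) {M ϑ : ℝ} (hϑ : 0 < ϑ)
    (hϑT : ϑ < 1 / T) (hb : ∀ z, |φ z| ≤ M * Real.exp (ϑ * (pinnedChain ω₂ lam β γ).hamiltonian N z))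
    (t : ℝ≥0) (x : PhaseSpace N) :
    Integrable (fun ω => φ ((pinnedChain ω₂ lam β γ).solMap N T T t x (pairPath ω))) wienerPair := by
  set P := pinnedChain ω₂ lam β γ with hP
  have hXm := pinnedChain_measurable_solMap_pairPath_right hω hl hβ hγ N T T t x
  have hϑ' : ϑ < 1 / max T T := by rwa [max_self]
  have h34 := pinnedChain_lintegral_exp_hamiltonian_solMap_le hω hl hβ hγ hN hT hT hϑ hϑ' t x
  refine ⟨(hφ.measurable.comp hXm).aestronglyMeasurable, ?_⟩
  have hm : Measurable fun ω => ENNReal.ofReal (Real.exp (ϑ * P.hamiltonian N (P.solMap N T T t x (pairPath ω)))) :=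
    ENNReal.measurable_ofReal.comp (Real.measurable_exp.comp
      (((pinnedChain_continuous_hamiltonian ω₂ lam β γ N).measurable.comp hXm).const_mul _))
  have hbound : ∀ ω, ‖φ (P.solMap N T T t x (pairPath ω))‖ₑ ≤
      ENNReal.ofReal |M| * ENNReal.ofReal (Real.exp (ϑ * P.hamiltonian N (P.solMap N T T t x (pairPath ω)))) := by
    intro ω
    rw [← ENNReal.ofReal_mul (abs_nonneg M), Real.enorm_eq_ofReal_abs]
    refine ENNReal.ofReal_le_ofReal ((hb _).trans ?_)
    exact mul_le_mul_of_nonneg_right (le_abs_self M) (Real.exp_pos _).le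
  calc ∫⁻ ω, ‖φ (P.solMap N T T t x (pairPath ω))‖ₑ ∂wienerPair
      ≤ ∫⁻ ω, ENNReal.ofReal |M| * ENNReal.ofReal (Real.exp (ϑ * P.hamiltonian N (P.solMap N T T t x (pairPath ω)))) ∂wienerPair :=
        lintegral_mono hbound
    _ = ENNReal.ofReal |M| * ∫⁻ ω, ENNReal.ofReal (Real.exp (ϑ * P.hamiltonian N (P.solMap N T T t x (pairPath ω)))) ∂wienerPair :=
        lintegral_const_mul _ hm
    _ < ⊤ := ENNReal.mul_lt_top ENNReal.ofReal_lt_top (lt_of_le_of_lt h34 ENNReal.ofReal_lt_top)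

/-- **Exponential moments of `√H` along the flow**: for `c : ℝ` and `t ≤ 1`,
`E exp(c √H(X_t^x)) ≤ exp((c²T/2 + γ) + (c²T/2 + 1/(2T)) √H(x))`
(`c√h ≤ θ h + c²/(4θ)` with `θ = 1/(2T(1 + √H(x))) < 1/T`, then (3.4) and `H(x)/(1+√H(x)) ≤ √H(x)`).
[cite: CuneoEckmannHairerReyBellet2018, §3 eq. (3.4)] -/
theorem lintegral_exp_mul_sqrt_hamiltonian_solMap_le (c : ℝ) (t : ℝ≥0) (ht : (t : ℝ) ≤ 1)
    (x : PhaseSpace N) :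
    ∫⁻ ω, ENNReal.ofReal (Real.exp (c * Real.sqrt ((pinnedChain ω₂ lam β γ).hamiltonian N
        ((pinnedChain ω₂ lam β γ).solMap N T T t x (pairPath ω))))) ∂wienerPair ≤
      ENNReal.ofReal (Real.exp ((c ^ 2 * T / 2 + γ) +
        (c ^ 2 * T / 2 + 1 / (2 * T)) * Real.sqrt ((pinnedChain ω₂ lam β γ).hamiltonian N x))) := by
  set P := pinnedChain ω₂ lam β γ with hP
  set h₀ := P.hamiltonian N x with hh₀
  have hh₀0 : 0 ≤ h₀ := pinnedChain_hamiltonian_nonneg hω.le hl hβ γ N x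
  set r := Real.sqrt h₀ with hr
  have hr0 : 0 ≤ r := Real.sqrt_nonneg _
  -- the exponent `θ = 1/(2T(1+r)) ∈ (0, 1/T)`
  set θ : ℝ := 1 / (2 * T * (1 + r)) with hθ
  have hθ0 : 0 < θ := by positivity
  have hθT : θ < 1 / T := by
    rw [hθ, div_lt_div_iff₀ (by positivity) hT]
    nlinarith
  have hθ' : θ < 1 / max T T := by rwa [max_self]
  have h34 := pinnedChain_lintegral_exp_hamiltonian_solMap_le hω hl hβ hγ hN hT hT hθ0 hθ' t x
  -- pointwise: `c √h ≤ θ h + c²/(4θ)`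
  have hpt : ∀ ω, ENNReal.ofReal (Real.exp (c * Real.sqrt (P.hamiltonian N (P.solMap N T T t x (pairPath ω))))) ≤
      ENNReal.ofReal (Real.exp (c ^ 2 / (4 * θ))) *
        ENNReal.ofReal (Real.exp (θ * P.hamiltonian N (P.solMap N T T t x (pairPath ω)))) := by
    intro ω
    set h := P.hamiltonian N (P.solMap N T T t x (pairPath ω))
    have hh : 0 ≤ h := pinnedChain_hamiltonian_nonneg hω.le hl hβ γ N _
    rw [← ENNReal.ofReal_mul (Real.exp_pos _).le, ← Real.exp_add]
    refine ENNReal.ofReal_le_ofReal (Real.exp_le_exp.2 ?_)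
    have := mul_sqrt_le (b := c) hh hθ0
    linarith
  refine (lintegral_mono hpt).trans ?_
  have hm : Measurable fun ω => ENNReal.ofReal (Real.exp (θ * P.hamiltonian N (P.solMap N T T t x (pairPath ω)))) :=
    ENNReal.measurable_ofReal.comp (Real.measurable_exp.comp
      (((pinnedChain_continuous_hamiltonian ω₂ lam β γ N).measurable.comp
        (pinnedChain_measurable_solMap_pairPath_right hω hl hβ hγ N T T t x)).const_mul _))
  rw [lintegral_const_mul _ hm]
  refine (mul_le_mul_right h34 _).trans ?_
  rw [← ENNReal.ofReal_mul (Real.exp_pos _).le, ← Real.exp_add, ← Real.exp_add]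
  refine ENNReal.ofReal_le_ofReal (Real.exp_le_exp.2 ?_)
  -- the exponent: `c²/(4θ) + θγ(T+T)t + θ h₀ ≤ (c²T/2 + γ) + (c²T/2 + 1/(2T)) r`
  have hθinv : c ^ 2 / (4 * θ) = c ^ 2 * T / 2 * (1 + r) := by
    rw [hθ]; field_simp; ring
  have h1 : θ * γ * (T + T) * t ≤ γ := by
    have hθle : θ * (T + T) ≤ 1 := by
      rw [hθ, div_mul_eq_mul_div, div_le_one (by positivity)]
      nlinarith
    have ht0 : (0 : ℝ) ≤ t := t.coe_nonneg
    calc θ * γ * (T + T) * t = γ * (θ * (T + T)) * t := by ring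
      _ ≤ γ * 1 * 1 := by gcongr
      _ = γ := by ring
  have h2 : θ * h₀ ≤ 1 / (2 * T) * r := by
    have hrr : h₀ = r * r := by rw [hr, Real.mul_self_sqrt hh₀0]
    rw [hθ, hrr, div_mul_eq_mul_div, div_mul_eq_mul_div, one_mul, one_mul,
      div_le_div_iff₀ (by positivity) (by positivity)]
    nlinarith [mul_nonneg hr0 hr0, hT]
  nlinarith [h1, h2, hθinv, mul_nonneg (sq_nonneg c) hT.le, mul_nonneg (mul_nonneg (sq_nonneg c) hT.le) hr0]

/-- **The exponential moment of the coupling rate.** For `C₀ ≥ 0`, `p > 0` and two starts `x, y`, with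
`Λ(ω) = ∫₀¹ C₀ (1 + √H(X_s^x ω) + √H(X_s^y ω)) ds`:
`E e^{pΛ} ≤ exp(p C₀ + (2p²C₀²T + γ) + (p²C₀²T + 1/(4T)) (√H(x) + √H(y)))`
(Jensen for the time average, Tonelli, Cauchy–Schwarz between the two starts, and
`lintegral_exp_mul_sqrt_hamiltonian_solMap_le` with `c = 2pC₀`). [folklore] -/
theorem lintegral_exp_mul_flowRate_le {C₀ : ℝ} (hC : 0 ≤ C₀) {p : ℝ} (hp : 0 < p) (x y : PhaseSpace N) :
    ∫⁻ ω, ENNReal.ofReal (Real.exp (p * ∫ s in (0 : ℝ)..1, C₀ * (1 +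
        Real.sqrt ((pinnedChain ω₂ lam β γ).hamiltonian N ((pinnedChain ω₂ lam β γ).solMap N T T s x (pairPath ω))) +
        Real.sqrt ((pinnedChain ω₂ lam β γ).hamiltonian N ((pinnedChain ω₂ lam β γ).solMap N T T s y (pairPath ω))))))
        ∂wienerPair ≤
      ENNReal.ofReal (Real.exp (p * C₀ + (2 * p ^ 2 * C₀ ^ 2 * T + γ) +
        (p ^ 2 * C₀ ^ 2 * T + 1 / (4 * T)) *
          (Real.sqrt ((pinnedChain ω₂ lam β γ).hamiltonian N x) +
            Real.sqrt ((pinnedChain ω₂ lam β γ).hamiltonian N y)))) := by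
  set P := pinnedChain ω₂ lam β γ with hP
  set H := P.hamiltonian N with hH
  have hHc : Continuous H := pinnedChain_continuous_hamiltonian ω₂ lam β γ N
  have hHm : Measurable H := hHc.measurable
  -- the rate integrand and its regularity
  set f : WienerPair → ℝ → ℝ := fun ω s => p * (C₀ * (1 + Real.sqrt (H (P.solMap N T T s x (pairPath ω))) +
    Real.sqrt (H (P.solMap N T T s y (pairPath ω))))) with hf
  have hfc : ∀ ω, Continuous (f ω) := fun ω => by
    have hx := pinnedChain_continuous_solMap hω hl hβ hγ N T T x (pairPath ω)
    have hy := pinnedChain_continuous_solMap hω hl hβ hγ N T T y (pairPath ω)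
    simp only [hf]
    fun_prop
  have hfm : Measurable (Function.uncurry f) := by
    have hux : Measurable fun q : WienerPair × ℝ => P.solMap N T T q.2 x (pairPath q.1) := by
      have h := pinnedChain_measurable_uncurry_solMap hω hl hβ hγ N T T
      exact h.comp (measurable_snd.prodMk ((measurable_const (a := x)).prodMk (measurable_pairPath.comp measurable_fst)))
    have huy : Measurable fun q : WienerPair × ℝ => P.solMap N T T q.2 y (pairPath q.1) := by
      have h := pinnedChain_measurable_uncurry_solMap hω hl hβ hγ N T T
      exact h.comp (measurable_snd.prodMk ((measurable_const (a := y)).prodMk (measurable_pairPath.comp measurable_fst)))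
    have : Function.uncurry f = fun q : WienerPair × ℝ => p * (C₀ * (1 + Real.sqrt (H (P.solMap N T T q.2 x (pairPath q.1))) +
        Real.sqrt (H (P.solMap N T T q.2 y (pairPath q.1))))) := by
      funext q; rfl
    rw [this]
    exact ((((hHm.comp hux).sqrt.const_add 1).add (hHm.comp huy).sqrt).const_mul _).const_mul _
  have hf0 : ∀ ω s, 0 ≤ f ω s := fun ω s => by
    simp only [hf]
    have := Real.sqrt_nonneg (H (P.solMap N T T s x (pairPath ω)))
    have := Real.sqrt_nonneg (H (P.solMap N T T s y (pairPath ω)))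
    positivity
  -- Step 1 (Jensen): `exp(∫₀¹ f) ≤ ∫₀¹ exp f`
  haveI : IsProbabilityMeasure ((volume : Measure ℝ).restrict (Ioc (0 : ℝ) 1)) :=
    ⟨by rw [Measure.restrict_apply_univ, Real.volume_Ioc]; simp⟩
  have hJ : ∀ ω, Real.exp (p * ∫ s in (0 : ℝ)..1, C₀ * (1 + Real.sqrt (H (P.solMap N T T s x (pairPath ω))) +
      Real.sqrt (H (P.solMap N T T s y (pairPath ω))))) ≤ ∫ s in Ioc (0 : ℝ) 1, Real.exp (f ω s) := by
    intro ω
    have hint : Integrable (f ω) ((volume : Measure ℝ).restrict (Ioc (0 : ℝ) 1)) :=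
      ((hfc ω).continuousOn.integrableOn_Icc (a := 0) (b := 1)).mono_set Ioc_subset_Icc_self
    have hint' : Integrable (Real.exp ∘ f ω) ((volume : Measure ℝ).restrict (Ioc (0 : ℝ) 1)) :=
      ((Real.continuous_exp.comp (hfc ω)).continuousOn.integrableOn_Icc (a := 0) (b := 1)).mono_set Ioc_subset_Icc_self
    have hj := (convexOn_exp).map_integral_le Real.continuous_exp.continuousOn isClosed_univ
      (Eventually.of_forall fun s => mem_univ (f ω s)) hint hint'
    have heq : p * ∫ s in (0 : ℝ)..1, C₀ * (1 + Real.sqrt (H (P.solMap N T T s x (pairPath ω))) +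
        Real.sqrt (H (P.solMap N T T s y (pairPath ω)))) = ∫ s in Ioc (0 : ℝ) 1, f ω s := by
      rw [intervalIntegral.integral_of_le zero_le_one, ← integral_const_mul]
    rw [heq]
    exact hj
  -- Step 2: pass to lower integrals and swap (Tonelli)
  have hstep2 : ∫⁻ ω, ENNReal.ofReal (∫ s in Ioc (0 : ℝ) 1, Real.exp (f ω s)) ∂wienerPair =
      ∫⁻ s in Ioc (0 : ℝ) 1, ∫⁻ ω, ENNReal.ofReal (Real.exp (f ω s)) ∂wienerPair := by
    have h1 : ∀ ω, ENNReal.ofReal (∫ s in Ioc (0 : ℝ) 1, Real.exp (f ω s)) =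
        ∫⁻ s in Ioc (0 : ℝ) 1, ENNReal.ofReal (Real.exp (f ω s)) := fun ω =>
      ofReal_integral_eq_lintegral_ofReal
        (((Real.continuous_exp.comp (hfc ω)).continuousOn.integrableOn_Icc (a := 0) (b := 1)).mono_set
          Ioc_subset_Icc_self) (Eventually.of_forall fun s => (Real.exp_pos _).le)
    simp_rw [h1]
    exact lintegral_lintegral_swap ((ENNReal.measurable_ofReal.comp (Real.measurable_exp.comp hfm)).aemeasurable)
  -- Step 3: the inner bound at a fixed time `s ∈ (0, 1]`
  set A : ℝ := (2 * p * C₀) ^ 2 * T / 2 + γ with hA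
  set B : ℝ := (2 * p * C₀) ^ 2 * T / 2 + 1 / (2 * T) with hB
  have hinner : ∀ s ∈ Ioc (0 : ℝ) 1, ∫⁻ ω, ENNReal.ofReal (Real.exp (f ω s)) ∂wienerPair ≤
      ENNReal.ofReal (Real.exp (p * C₀ + A + B / 2 * (Real.sqrt (H x) + Real.sqrt (H y)))) := by
    intro s hs
    have hs' : ((s.toNNReal : ℝ≥0) : ℝ) = s := Real.coe_toNNReal s hs.1.le
    have hsle : ((s.toNNReal : ℝ≥0) : ℝ) ≤ 1 := by rw [hs']; exact hs.2
    -- split `exp(f) = e^{pC₀} · e^{pC₀ √H(X)} · e^{pC₀ √H(Y)}`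
    set a : WienerPair → ℝ := fun ω => Real.exp (p * C₀ * Real.sqrt (H (P.solMap N T T s x (pairPath ω)))) with ha
    set b : WienerPair → ℝ := fun ω => Real.exp (p * C₀ * Real.sqrt (H (P.solMap N T T s y (pairPath ω)))) with hb
    have hsplit : ∀ ω, ENNReal.ofReal (Real.exp (f ω s)) = ENNReal.ofReal (Real.exp (p * C₀)) * ENNReal.ofReal (a ω * b ω) := by
      intro ω
      rw [← ENNReal.ofReal_mul (Real.exp_pos _).le, ha, hb, ← Real.exp_add, ← Real.exp_add]
      congr 1; simp only [hf]; ring_nf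
    simp_rw [hsplit]
    have hXm := pinnedChain_measurable_solMap_pairPath_right hω hl hβ hγ N T T s x
    have hYm := pinnedChain_measurable_solMap_pairPath_right hω hl hβ hγ N T T s y
    have ham : Measurable a := Real.measurable_exp.comp ((hHm.comp hXm).sqrt.const_mul _)
    have hbm : Measurable b := Real.measurable_exp.comp ((hHm.comp hYm).sqrt.const_mul _)
    have hm2 : Measurable fun ω => ENNReal.ofReal (a ω * b ω) := ENNReal.measurable_ofReal.comp (ham.mul hbm)
    rw [lintegral_const_mul _ hm2]
    -- second moments of `a` and `b` by the `√H`-moment bound with `c = 2pC₀`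
    have hmomx := lintegral_exp_mul_sqrt_hamiltonian_solMap_le hω hl hβ hγ hN hT (2 * p * C₀) s.toNNReal hsle x
    have hmomy := lintegral_exp_mul_sqrt_hamiltonian_solMap_le hω hl hβ hγ hN hT (2 * p * C₀) s.toNNReal hsle y
    rw [hs'] at hmomx hmomy
    have ha2 : ∀ ω, a ω ^ 2 = Real.exp (2 * p * C₀ * Real.sqrt (H (P.solMap N T T s x (pairPath ω)))) := fun ω => by
      rw [ha, ← Real.exp_nat_mul]; push_cast; ring_nf
    have hb2 : ∀ ω, b ω ^ 2 = Real.exp (2 * p * C₀ * Real.sqrt (H (P.solMap N T T s y (pairPath ω)))) := fun ω => by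
      rw [hb, ← Real.exp_nat_mul]; push_cast; ring_nf
    have hIa : ∫⁻ ω, ENNReal.ofReal (a ω ^ 2) ∂wienerPair ≤ ENNReal.ofReal (Real.exp (A + B * Real.sqrt (H x))) := by
      simp_rw [ha2]; exact hmomx
    have hIb : ∫⁻ ω, ENNReal.ofReal (b ω ^ 2) ∂wienerPair ≤ ENNReal.ofReal (Real.exp (A + B * Real.sqrt (H y))) := by
      simp_rw [hb2]; exact hmomy
    have hcs := lintegral_ofReal_mul_le wienerPair ham hbm (fun ω => (Real.exp_pos _).le) (fun ω => (Real.exp_pos _).le)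
      (Real.exp_pos _).le (Real.exp_pos _).le hIa hIb
    refine (mul_le_mul_right hcs _).trans (le_of_eq ?_)
    have hsq_exp : ∀ u : ℝ, Real.sqrt (Real.exp u) = Real.exp (u / 2) := fun u => by
      rw [Real.sqrt_eq_iff_mul_self_eq_of_pos (Real.exp_pos _), ← Real.exp_add]; ring_nf
    rw [hsq_exp, hsq_exp, ← ENNReal.ofReal_mul (Real.exp_pos _).le, ← Real.exp_add, ← Real.exp_add]
    congr 2; ring
  -- Step 4: assemble
  have hmeas_lhs : ∀ ω, ENNReal.ofReal (Real.exp (p * ∫ s in (0 : ℝ)..1, C₀ * (1 +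
      Real.sqrt (H (P.solMap N T T s x (pairPath ω))) + Real.sqrt (H (P.solMap N T T s y (pairPath ω)))))) ≤
      ENNReal.ofReal (∫ s in Ioc (0 : ℝ) 1, Real.exp (f ω s)) := fun ω => ENNReal.ofReal_le_ofReal (hJ ω)
  refine (lintegral_mono hmeas_lhs).trans ?_
  rw [hstep2]
  calc ∫⁻ s in Ioc (0 : ℝ) 1, ∫⁻ ω, ENNReal.ofReal (Real.exp (f ω s)) ∂wienerPair
      ≤ ∫⁻ _s in Ioc (0 : ℝ) 1, ENNReal.ofReal (Real.exp (p * C₀ + A + B / 2 * (Real.sqrt (H x) + Real.sqrt (H y)))) :=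
        setLIntegral_mono measurable_const hinner
    _ = ENNReal.ofReal (Real.exp (p * C₀ + A + B / 2 * (Real.sqrt (H x) + Real.sqrt (H y)))) := by
        rw [setLIntegral_const, Real.volume_Ioc]; simp
    _ = _ := by rw [hA, hB]; congr 2; ring

end Flow

/-- **Registered form of this file's principal estimate** (`stub_lasotaYorke_aux2`, closed statement of
`lintegral_exp_mul_sqrt_hamiltonian_solMap_le`): exponential moments of `√H` along the flow up to time `1`.
[cite: CuneoEckmannHairerReyBellet2018, §3 eq. (3.4)] -/
theorem stub_lasotaYorke_aux2 :
    ∀ ω₂ lam β γ : ℝ, 0 < ω₂ → 0 ≤ lam → 0 ≤ β → 0 ≤ γ → ∀ N : ℕ, 0 < N → ∀ T : ℝ, 0 < T → ∀ (c : ℝ) (t : ℝ≥0), (t : ℝ) ≤ 1 → ∀ x : PhaseSpace N, ∫⁻ ω, ENNReal.ofReal (Real.exp (c * Real.sqrt ((pinnedChain ω₂ lam β γ).hamiltonian N ((pinnedChain ω₂ lam β γ).solMap N T T t x (pairPath ω))))) ∂wienerPair ≤ ENNReal.ofReal (Real.exp ((c ^ 2 * T / 2 + γ) + (c ^ 2 *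 T / 2 + 1 / (2 * T)) * Real.sqrt ((pinnedChain ω₂ lam β γ).hamiltonian N x))) :=
  fun _ _ _ _ hω hl hβ hγ _ hN _ hT c t ht x =>
    lintegral_exp_mul_sqrt_hamiltonian_solMap_le hω hl hβ hγ hN hT c t ht x

end Summit.AtomisticToContinuum.FouriersLaw.Cruxes.StaticKubo.Birth.Stubs

end
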